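import Summits.BirchSwinnertonDyer.Rank1Residual.GaloisImage.KolyvaginDerivativeCocycleWitnesses

/-!
# The cocycle step of THEOREM D-tr: a derivative class whose Frobenius-difference is divisible
# by `M` up to coboundaries is transverse at the decomposition group — file 2 of row T-DER-TR
# (cell `b2b-bsdres`, team n1011, seat p15 GEN 8, OWNERS row T-DER-TR = skel/T-DER-TR.md)

HONEST FRAMING (cell `b2b-bsdres`, run/shared/lean/b2b/bsd-rank1-residual/, verbatim in every
file): the goal of the cell is to DELETE the COMBINATION-SHAPED residual classes of the
Birch–Swinnerton-Dyer formula for ALL analytic-rank `≤ 1` elliptic curves over `ℚ` — "full BSD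
formula for every rank `≤ 1` curve in class `C`" assembled STRICTLY from published theorems — so
that the rank-`≤ 1` remainder becomes exactly the CONSTRUCTION-SHAPED classes, which are TYPED
(missing-input `Prop`s), NOT attempted. This is not "finishing BSD". Team n1011: research route on
the CONSTRUCTION-SHAPED class X4 / §I N11 (route-1 PORT, (P-DER)); TOOL theorems of continuous
group cohomology (no definition, no named fact, no `sorry`); curve-free, `p`-free.

## What (replaces [MR04] App. A, Prop. A.8 + Prop. A.15 + the injectivity of `res_I` (38), in the
## case where the finite projection is to be shown ZERO)

Setting: a topological group `G` (`= Γ_K`), two topological representations `Xt` (`= T`) and `X`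
(`= W = T/M`) with an equivariant map `f : Xt ⟶ X` killing `M • Xt`, a normal subgroup `N`
(`= U_n = Gal(K̄/K(n))`), a subgroup `D` (the decomposition group of a prime `𝔔 ∣ q`, `q ∈ n`) and
a subgroup `U` (`= U_q`), an element `Fr ∈ D` (an arithmetic Frobenius of `𝔔` chosen INSIDE `U_q`,
[MR04] p. 85: "Fix a representative `Fr_ℓ ∈ G(n)` so that `Fr_ℓ = 1` on `ℚ(ℓ)`"), an `N`-cocycle
`Ψ̃` with values in `Xt` (`= D_n x̃″_n`, the `T`-valued derivative cocycle) and the global `X`-valued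
cocycle `Φ` extending `f ∘ Ψ̃` up to a coboundary `∂w₀` (the derivative class `κ_n`, THEOREM A3 / C1
`exists_extend_of_forall_conjMap_eq`).
* `eq_rho_sub_sub_smul_of_local_coboundary` — **(β) the `T`-level evaluation**: if
  `Fr·Ψ̃(Fr⁻¹uFr) − Ψ̃(u) = M • z(u) + (u ẽ − ẽ)` on `N` (the output of file 1's augmentation-square
  lemma, at cocycle level), and on `D ∩ N` both `Ψ̃` and `z` are coboundaries `∂t̃`, `∂s̃` (the
  classes vanish at the prime `𝔔` — the semi-local congruence), and `Xt^{D ∩ N} = 0` (for `T_pE`: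
  `ρ(Fr)^k − 1` is injective, Weil), then `ẽ = Fr t̃ − t̃ − M • s̃` EXACTLY;
* `apply_eq_of_smul_witness` — **(α)** the value of the global class at `Fr` is `f ẽ`
  (C1 `apply_eq_of_forall_witness`: a witness IS the value, `X^N = 0`), hence `= Fr·(f t̃) − f t̃`;
* `apply_eq_rho_sub_of_frobenius_generates` — **(γ)** a global cocycle which is the coboundary of
  `t` on `D ∩ N` and at `Fr` is the coboundary of `t` on every `d ∈ D ∩ U` of the form `Fr^a · u`,
  `u ∈ D ∩ N` (Frobenius generates the decomposition group of the UNRAMIFIED extension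
  `K(n)/K(q)` at `𝔔`);
* `resSubgroup_inf_eq_zero_of_local_coboundary` — **THEOREM D-tr, generic form**: under the
  hypotheses above, `res_{D ∩ U} [Φ] = 0` — the class `κ_n` restricted to `Gal(K̄_q/K_q(μ_q))`
  vanishes: `loc_q κ_n` is TRANSVERSE ([MR04] Thm. A.4 ⇒ `(κ_n)_{q,f} = 0` when every
  `P_ℓ ≡ (X−1)²`).
Pure pointwise algebra of crossed homomorphisms; no number theory.  The instantiation for the
Euler system (`Xt = T`, the modified classes `x″`, `S` = classes vanishing above `q`, `V = M • S`)
is file 3 `KolyvaginTransverseClasses`; the `E/ℚ` END is file 4.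

References: B. Mazur, K. Rubin, *Kolyvagin systems*, Mem. AMS 799 (2004), App. A pp. 83–87
(Lemma A.6, Def. A.7, Prop. A.8, Def. A.14, Prop. A.15, proof of Thm. A.4); J.-P. Serre, *Galois
Cohomology*, I §2, I §5.
-/

noncomputable section

open CategoryTheory Function Field
open Literature.NumberTheory.GaloisRepresentations
open Literature.NumberTheory.EllipticCurves (subgroupConj subgroupConj_apply_coe subgroupConj_one)

universe u v

namespace Summit.BirchSwinnertonDyer.Rank1Residual.GaloisImage

namespace Derivative

namespace Transverse

variable {R : Type v} [CommRing R] [TopologicalSpace R]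
variable {G : Type u} [Group G] [TopologicalSpace G] [IsTopologicalGroup G]

/-! ### §1 (β) The `T`-level evaluation at the decomposition group -/

section Beta

variable (X : TopRep.{u} R G) (N D : Subgroup G) [N.Normal]

/-- **(β) The `T`-level evaluation.**  Let `Fr ∈ D`, let `Ψ, z : N → X` be any maps (the values of
two `N`-cocycles), `M : R`, `e t s : X` with
`Fr·Ψ(Fr⁻¹ u Fr) − Ψ(u) = M • z(u) + (u e − e)` for all `u ∈ N`, and suppose that on `D ∩ N` both
`Ψ` and `z` are the coboundaries of `t` and `s`.  If `X^{D ∩ N} = 0`, then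
`e = Fr t − t − M • s`.  (Evaluating at `u ∈ D ∩ N`: `(u − 1)(Fr t − t − M s − e) = 0`.)  Replaces
[MR04] Prop. A.8/A.15: no `Maps(G_K, T)`-resolution is needed when the finite projection is to be
shown zero. [folklore] -/
theorem eq_rho_sub_sub_smul_of_local_coboundary {Fr : G} (hFr : Fr ∈ D) (Ψ z : N → X) (M : R)
    (e t s : X)
    (hW : ∀ u : N, X.ρ Fr (Ψ (subgroupConj N Fr u)) - Ψ u = M • z u + (X.ρ (u : G) e - e))
    (ht : ∀ u : N, (u : G) ∈ D → Ψ u = X.ρ (u : G) t - t)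
    (hs : ∀ u : N, (u : G) ∈ D → z u = X.ρ (u : G) s - s)
    (h0 : ∀ x : X, (∀ u : N, (u : G) ∈ D → X.ρ (u : G) x = x) → x = 0) :
    e = X.ρ Fr t - t - M • s := by
  -- the difference is fixed by `D ∩ N`
  have hfix : ∀ u : N, (u : G) ∈ D → X.ρ (u : G) (X.ρ Fr t - t - M • s - e) = X.ρ Fr t - t - M • s - e := by
    intro u hu
    have hcu : ((subgroupConj N Fr u : N) : G) ∈ D := by
      rw [subgroupConj_apply_coe]
      exact D.mul_mem (D.mul_mem (D.inv_mem hFr) hu) hFr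
    have h := hW u
    rw [ht _ hcu, hs _ hu, ht _ hu, subgroupConj_apply_coe, map_sub, ← ρ_mul_apply,
      show Fr * (Fr⁻¹ * ↑u * Fr) = ↑u * Fr by group, ρ_mul_apply] at h
    -- `h : u (Fr t) − Fr t − (u t − t) = M • (u s − s) + (u e − e)`
    rw [smul_sub, ← sub_eq_zero] at h
    have h' : X.ρ (u : G) (X.ρ Fr t - t - M • s - e) - (X.ρ Fr t - t - M • s - e) = 0 := by
      simp only [map_sub, map_smul]
      calc X.ρ (u : G) (X.ρ Fr t) - X.ρ (u : G) t - M • X.ρ (u : G) s - X.ρ (u : G) e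
              - (X.ρ Fr t - t - M • s - e)
          = X.ρ (u : G) (X.ρ Fr t) - X.ρ Fr t - (X.ρ (u : G) t - t)
              - (M • X.ρ (u : G) s - M • s + (X.ρ (u : G) e - e)) := by abel
        _ = 0 := h
    exact sub_eq_zero.mp h'
  have hzero := h0 _ hfix
  -- `Fr t − t − M • s − e = 0`
  rw [sub_eq_zero] at hzero
  exact hzero.symm

end Beta

/-! ### §2 (α) The value of the global class at `Fr` -/

section Alpha

variable (Xt X : TopRep.{u} R G) (f : Xt ⟶ X) (N : Subgroup G) [N.Normal]

/-- **(α) The value at `Fr` of the global class extending `f ∘ Ψ̃`.**  If `X^N = 0`, `Φ` is a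
global cocycle with `Φ|_N = f ∘ Ψ̃ + ∂w₀`, `f` kills `M • Xt`, and
`Fr·Ψ̃(Fr⁻¹ u Fr) − Ψ̃(u) = M • z(u) + (u ẽ − ẽ)` on `N`, then `Φ(Fr) = f ẽ + (Fr w₀ − w₀)` (C1
`apply_eq_of_forall_witness`: the reduction of the `T`-level witness is a witness, and a witness
IS the value).  [PerrinRiou98] §3.1.2. [folklore] -/
theorem apply_eq_of_smul_witness (h0 : ∀ v : X, (∀ n : N, X.ρ (n : G) v = v) → v = 0)
    (Φ : contOneCocycles X) (Ψ z : N → Xt) (w₀ : X)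
    (hΦ : ∀ n : N, Φ.1 n = f.hom (Ψ n) + (X.ρ (n : G) w₀ - w₀)) {M : R}
    (hM : ∀ x : Xt, f.hom (M • x) = 0) (Fr : G) (e : Xt)
    (hW : ∀ u : N, Xt.ρ Fr (Ψ (subgroupConj N Fr u)) - Ψ u = M • z u + (Xt.ρ (u : G) e - e)) :
    Φ.1 Fr = f.hom e + (X.ρ Fr w₀ - w₀) := by
  refine apply_eq_of_forall_witness X N h0 Φ Fr _ fun u => ?_
  have hW' := congrArg f.hom (hW u)
  rw [map_sub, map_add, hM, zero_add, map_sub, TopRep.hom_comm_apply, TopRep.hom_comm_apply] at hW'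
  rw [hΦ, hΦ, subgroupConj_apply_coe, map_add, map_sub, ← ρ_mul_apply,
    show Fr * (Fr⁻¹ * ↑u * Fr) = ↑u * Fr by group, ρ_mul_apply, map_add, map_sub]
  -- `Fr·f(Ψ(Fr⁻¹uFr)) + (u Fr w₀ − Fr w₀) − (f(Ψ u) + (u w₀ − w₀)) = u(f e + Fr w₀ − w₀) − (f e + Fr w₀ − w₀)`
  have e1 : X.ρ Fr (f.hom (Ψ (subgroupConj N Fr u))) - f.hom (Ψ u) = X.ρ (u : G) (f.hom e) - f.hom e := hW'
  calc X.ρ Fr (f.hom (Ψ (subgroupConj N Fr u))) + (X.ρ (u : G) (X.ρ Fr w₀) - X.ρ Fr w₀)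
          - (f.hom (Ψ u) + (X.ρ (u : G) w₀ - w₀))
      = (X.ρ Fr (f.hom (Ψ (subgroupConj N Fr u))) - f.hom (Ψ u))
          + (X.ρ (u : G) (X.ρ Fr w₀) - X.ρ Fr w₀ - (X.ρ (u : G) w₀ - w₀)) := by abel
    _ = (X.ρ (u : G) (f.hom e) - f.hom e)
          + (X.ρ (u : G) (X.ρ Fr w₀) - X.ρ Fr w₀ - (X.ρ (u : G) w₀ - w₀)) := by rw [e1]
    _ = X.ρ (u : G) (f.hom e) + (X.ρ (u : G) (X.ρ Fr w₀) - X.ρ (u : G) w₀)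
          - (f.hom e + (X.ρ Fr w₀ - w₀)) := by abel

end Alpha

/-! ### §3 (γ) A cocycle which is a coboundary on `D ∩ N` and at `Fr` is a coboundary on `D ∩ U` -/

section Gamma

variable (X : TopRep.{u} R G)

omit [IsTopologicalGroup G] in
/-- Powers: if `Φ(Fr) = Fr t − t` then `Φ(Fr^a) = Fr^a t − t`. [folklore] -/
theorem apply_pow_eq_rho_sub (Φ : contOneCocycles X) {Fr : G} {t : X}
    (hFr : Φ.1 Fr = X.ρ Fr t - t) (a : ℕ) : Φ.1 (Fr ^ a) = X.ρ (Fr ^ a) t - t := by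
  induction a with
  | zero => rw [pow_zero, contOneCocycles.apply_one, map_one]; exact (sub_self _).symm
  | succ a ih =>
    rw [pow_succ, Φ.2 (Fr ^ a) Fr, ih, hFr, map_sub, ← ρ_mul_apply]
    abel

omit [IsTopologicalGroup G] in
/-- **(γ) Frobenius generates the decomposition group.**  If a global cocycle `Φ` is the
coboundary of `t` on `D ∩ N` and `Φ(Fr) = Fr t − t`, then `Φ(d) = d t − t` for every `d` of the form
`Fr^a · u` with `u ∈ D ∩ N` — in the application every `d ∈ D ∩ U_q`, because the decomposition
group at `𝔔` of the unramified extension `K(n)/K(q)` is generated by the Frobenius ([MR04] L. A.6).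
[folklore] -/
theorem apply_eq_rho_sub_of_frobenius_generates (N D U : Subgroup G) (Φ : contOneCocycles X)
    {Fr : G} {t : X} (hN : ∀ u ∈ D, u ∈ N → Φ.1 u = X.ρ u t - t) (hFr : Φ.1 Fr = X.ρ Fr t - t)
    (hgen : ∀ d ∈ D, d ∈ U → ∃ a : ℕ, ∃ u ∈ D, u ∈ N ∧ d = Fr ^ a * u) :
    ∀ d ∈ D, d ∈ U → Φ.1 d = X.ρ d t - t := by
  intro d hdD hdU
  obtain ⟨a, u, huD, huN, rfl⟩ := hgen d hdD hdU
  rw [Φ.2 (Fr ^ a) u, apply_pow_eq_rho_sub X Φ hFr a, hN u huD huN, map_sub, ← ρ_mul_apply]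
  abel

/-- A global cocycle which is pointwise the coboundary of `t` on a subgroup `H` restricts to zero
in `H¹(H, X)`. [folklore] -/
theorem resSubgroup_oneCocycleClass_eq_zero_of_forall (H : Subgroup G) (Φ : contOneCocycles X) (t : X)
    (h : ∀ d ∈ H, Φ.1 d = X.ρ d t - t) : resSubgroup X H 1 (oneCocycleClass X Φ) = 0 := by
  rw [resSubgroup_oneCocycleClass, oneCocycleClass_eq_zero_iff]
  refine ⟨t, fun d => ?_⟩
  rw [contOneCocycles.pullback_apply, subgroupRep_ρ_apply]
  exact h d d.2

end Gamma

/-! ### §4 THEOREM D-tr, generic form -/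

section Main

variable (Xt X : TopRep.{u} R G) (f : Xt ⟶ X) (N D U : Subgroup G) [N.Normal]

/-- **THEOREM D-tr (generic): the derivative class is transverse at the decomposition group.**
Data: `f : Xt ⟶ X` equivariant killing `M • Xt`; `N ⊴ G` with `X^N = 0`; subgroups `D ∋ Fr` and
`U`; an `N`-cocycle-valued map `Ψ̃ : N → Xt` and `z : N → Xt`; the global cocycle `Φ` with
`Φ|_N = f ∘ Ψ̃ + ∂w₀` (any representative of the derivative class).  Hypotheses: (W) `Fr·Ψ̃(Fr⁻¹uFr) − Ψ̃(u) = M • z(u) + (u ẽ − ẽ)` on `N` (file 1's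
augmentation-square lemma at cocycle level: `(Fr − 1) D_n x̃″_n ∈ M • S + B¹`); (t),(s) on `D ∩ N`,
`Ψ̃ = ∂t̃` and `z = ∂s̃` (the classes vanish at `𝔔`: the semi-local congruence); (0) `Xt^{D∩N} = 0`
(Weil); (gen) every `d ∈ D ∩ U` is `Fr^a u` with `u ∈ D ∩ N` (Frobenius generates).  Conclusion:
`res_{D ⊓ U} [Φ] = 0` — with `D ⊓ U ⊇ Gal(K̄_q/K_q(μ_q))` this is `loc_q κ_n ∈ H¹_tr(K_q, W)`,
i.e. `(κ_n)_{q,f} = 0` ([MR04] Thm. A.4 in the case `P_ℓ ≡ (X−1)²`, where the modification (33) is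
the identity).  Proof: (β) `ẽ = Fr t̃ − t̃ − M s̃`; (α) `Φ(Fr) = f ẽ = Fr·f t̃ − f t̃`; (γ).
[cite: MazurRubin2004, App. A, Thm. A.4 and its proof (pp. 80, 83–87)] -/
theorem resSubgroup_inf_eq_zero_of_local_coboundary
    (h0 : ∀ v : X, (∀ n : N, X.ρ (n : G) v = v) → v = 0)
    (Φ : contOneCocycles X) (Ψ z : N → Xt) (w₀ : X)
    (hΦ : ∀ n : N, Φ.1 n = f.hom (Ψ n) + (X.ρ (n : G) w₀ - w₀)) {M : R}
    (hM : ∀ x : Xt, f.hom (M • x) = 0) {Fr : G} (hFrD : Fr ∈ D) (e t s : Xt)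
    (hW : ∀ u : N, Xt.ρ Fr (Ψ (subgroupConj N Fr u)) - Ψ u = M • z u + (Xt.ρ (u : G) e - e))
    (ht : ∀ u : N, (u : G) ∈ D → Ψ u = Xt.ρ (u : G) t - t)
    (hs : ∀ u : N, (u : G) ∈ D → z u = Xt.ρ (u : G) s - s)
    (h0loc : ∀ x : Xt, (∀ u : N, (u : G) ∈ D → Xt.ρ (u : G) x = x) → x = 0)
    (hgen : ∀ d ∈ D, d ∈ U → ∃ a : ℕ, ∃ u ∈ D, u ∈ N ∧ d = Fr ^ a * u) :
    resSubgroup X (D ⊓ U) 1 (oneCocycleClass X Φ) = 0 := by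
  -- (β)
  have he : e = Xt.ρ Fr t - t - M • s :=
    eq_rho_sub_sub_smul_of_local_coboundary Xt N D hFrD Ψ z M e t s hW ht hs h0loc
  -- (α)
  have hFr : Φ.1 Fr = X.ρ Fr (f.hom t + w₀) - (f.hom t + w₀) := by
    rw [apply_eq_of_smul_witness Xt X f N h0 Φ Ψ z w₀ hΦ hM Fr e hW, he, map_sub, map_sub, hM,
      sub_zero, TopRep.hom_comm_apply, map_add]
    abel
  -- `Φ` is the coboundary of `f t + w₀` on `D ∩ N`
  have hN : ∀ u ∈ D, u ∈ N → Φ.1 u = X.ρ u (f.hom t + w₀) - (f.hom t + w₀) := by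
    intro u huD huN
    have h := hΦ ⟨u, huN⟩
    rw [ht ⟨u, huN⟩ huD, map_sub, TopRep.hom_comm_apply] at h
    rw [h, map_add]
    abel
  -- (γ)
  have hall := apply_eq_rho_sub_of_frobenius_generates X N D U Φ hN hFr hgen
  exact resSubgroup_oneCocycleClass_eq_zero_of_forall X (D ⊓ U) Φ (f.hom t + w₀)
    fun d hd => hall d hd.1 hd.2

/-- The same with the conclusion stated for any subgroup `H ≤ D ⊓ U` (in the application
`H` = the image of `Gal(K̄_q/K_q(μ_q))` in `Γ_K`): `res_H [Φ] = 0`. [folklore] -/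
theorem resSubgroup_eq_zero_of_local_coboundary_of_le
    (h0 : ∀ v : X, (∀ n : N, X.ρ (n : G) v = v) → v = 0)
    (Φ : contOneCocycles X) (Ψ z : N → Xt) (w₀ : X)
    (hΦ : ∀ n : N, Φ.1 n = f.hom (Ψ n) + (X.ρ (n : G) w₀ - w₀)) {M : R}
    (hM : ∀ x : Xt, f.hom (M • x) = 0) {Fr : G} (hFrD : Fr ∈ D) (e t s : Xt)
    (hW : ∀ u : N, Xt.ρ Fr (Ψ (subgroupConj N Fr u)) - Ψ u = M • z u + (Xt.ρ (u : G) e - e))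
    (ht : ∀ u : N, (u : G) ∈ D → Ψ u = Xt.ρ (u : G) t - t)
    (hs : ∀ u : N, (u : G) ∈ D → z u = Xt.ρ (u : G) s - s)
    (h0loc : ∀ x : Xt, (∀ u : N, (u : G) ∈ D → Xt.ρ (u : G) x = x) → x = 0)
    (hgen : ∀ d ∈ D, d ∈ U → ∃ a : ℕ, ∃ u ∈ D, u ∈ N ∧ d = Fr ^ a * u)
    {H : Subgroup G} (hH : H ≤ D ⊓ U) :
    resSubgroup X H 1 (oneCocycleClass X Φ) = 0 := by
  have he : e = Xt.ρ Fr t - t - M • s :=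
    eq_rho_sub_sub_smul_of_local_coboundary Xt N D hFrD Ψ z M e t s hW ht hs h0loc
  have hFr : Φ.1 Fr = X.ρ Fr (f.hom t + w₀) - (f.hom t + w₀) := by
    rw [apply_eq_of_smul_witness Xt X f N h0 Φ Ψ z w₀ hΦ hM Fr e hW, he, map_sub, map_sub, hM,
      sub_zero, TopRep.hom_comm_apply, map_add]
    abel
  have hN : ∀ u ∈ D, u ∈ N → Φ.1 u = X.ρ u (f.hom t + w₀) - (f.hom t + w₀) := by
    intro u huD huN
    have h := hΦ ⟨u, huN⟩
    rw [ht ⟨u, huN⟩ huD, map_sub, TopRep.hom_comm_apply] at h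
    rw [h, map_add]
    abel
  have hall := apply_eq_rho_sub_of_frobenius_generates X N D U Φ hN hFr hgen
  exact resSubgroup_oneCocycleClass_eq_zero_of_forall X H Φ (f.hom t + w₀)
    fun d hd => hall d (hH hd).1 (hH hd).2

end Main

end Transverse

end Derivative

end Summit.BirchSwinnertonDyer.Rank1Residual.GaloisImage

end
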